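import Summits.AnomalousDissipation.AnomalousDissipation.Theorems.BaireTransferDenseLoudDesignerForcesErgodicLine
import Literature.Analysis.FunctionSpaces.TorusClassicalNSUniqueness
import Literature.Analysis.FunctionSpaces.TorusFourierCalculus
import Literature.Analysis.FluidPDE.NSStrongSolutions2D
import Literature.Analysis.FluidPDE.StatisticalSolutionProofs
import HarnessLib

/-!
# Stub `stub_phaseOfCompactLimits` of the line `SketchIdeator2` (card `separatrix-flux-pinning`),
# helper file A: `L²`/`Ḣ¹` bookkeeping on `T³` and the phase space `H`
# (crux `MarginalStabilityChain.ChainRealisation`, stmt-AnomalousDissipation-14249)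

Elementary inequalities used by the construction of the NS phase from compact limits of
time-translates (`…StubPhaseOfCompactLimits.lean`):

* the `δ`-Young form of the triangle inequality `‖p‖² ≤ (1+δ)‖q‖² + (1+δ⁻¹)‖p-q‖²`, integrated:
  `∫‖f‖² ≤ (1+δ)∫‖g‖² + (1+δ⁻¹)∫‖f-g‖²` and `‖∇f‖₂² ≤ (1+δ)‖∇g‖₂² + (1+δ⁻¹)‖∇(f-g)‖₂²`
  (`gradNormSq = ∫ ∑ᵢ ‖∂ᵢ·‖²`, `Torus.partialDeriv_sub`), whence the two-out-of-three inequalities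
  (`δ = 1`) and the continuity of `‖∇·‖₂²` along `Ḣ¹`-convergent sequences of smooth fields;
* time continuity in `L²` and `Ḣ¹` of a jointly smooth field on `[0,∞) × T³` (tube lemma
  `Torus.IsSmoothSpaceTimeOn.eventually_norm_sub_lt` for the field and its partial derivatives);
* the phase space `H = Torus.energySpace (Fin 3)` (`Hsp`, representatives `rep`): the `H`-distance is
  the `L²`-distance of representatives, a.e.-equal representatives give equal states, smooth
  solenoidal mean-zero fields have classes in `H`, and the enstrophy observable of a state
  represented by a smooth field is its classical `‖∇·‖₂²`.

References: C. Foias, O. Manley, R. Rosa, R. Temam, *Navier–Stokes Equations and Turbulence*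
(CUP 2001), Ch. III §2, Ch. IV §1; P. Constantin, C. Foias, *Navier–Stokes Equations* (1988), Ch. 4.
-/

set_option linter.dupNamespace false

noncomputable section

open MeasureTheory Set Filter Topology
open scoped InnerProductSpace
open Literature.Analysis.FunctionSpaces Literature.Analysis.FunctionSpaces.Torus
open Literature.Analysis.FluidPDE

namespace Summit.AnomalousDissipation.AnomalousDissipation.Theorems.ChainRealisation.SeparatrixFluxPinning

open Summit.AnomalousDissipation.AnomalousDissipation.Theorems.DenseLoudDesignerForces.Ergodic
open Literature.Analysis.FluidPDE.Torus

/-! ## `δ`-Young inequalities in `L²` and `Ḣ¹` -/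

/-- Pointwise `δ`-Young form of the triangle inequality in a seminormed group:
`‖p‖² ≤ (1+δ)‖q‖² + (1+δ⁻¹)‖p - q‖²` for `δ > 0`. -/
theorem phaseCL_norm_sq_le_delta {G : Type*} [SeminormedAddCommGroup G] (p q : G) {δ : ℝ}
    (hδ : 0 < δ) : ‖p‖ ^ 2 ≤ (1 + δ) * ‖q‖ ^ 2 + (1 + δ⁻¹) * ‖p - q‖ ^ 2 := by
  have h1 : ‖p‖ ≤ ‖q‖ + ‖p - q‖ := norm_le_norm_add_norm_sub' p q
  have h2 : ‖p‖ ^ 2 ≤ (‖q‖ + ‖p - q‖) ^ 2 := pow_le_pow_left₀ (norm_nonneg _) h1 2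
  have h3 : (‖q‖ + ‖p - q‖) ^ 2 ≤ (1 + δ) * ‖q‖ ^ 2 + (1 + δ⁻¹) * ‖p - q‖ ^ 2 := by
    have key : (1 + δ) * ‖q‖ ^ 2 + (1 + δ⁻¹) * ‖p - q‖ ^ 2 - (‖q‖ + ‖p - q‖) ^ 2 =
        (δ * ‖q‖ - ‖p - q‖) ^ 2 / δ := by
      field_simp
      ring
    have h4 : 0 ≤ (δ * ‖q‖ - ‖p - q‖) ^ 2 / δ := div_nonneg (sq_nonneg _) hδ.le
    linarith
  exact h2.trans h3

/-- `∫‖f‖² ≤ (1+δ)∫‖g‖² + (1+δ⁻¹)∫‖f - g‖²` for continuous fields on `T³`. -/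
theorem phaseCL_integral_norm_sq_le_delta {f g : UnitAddTorus (Fin 3) → EuclideanSpace ℝ (Fin 3)} (hf : Continuous f) (hg : Continuous g)
    {δ : ℝ} (hδ : 0 < δ) :
    ∫ x, ‖f x‖ ^ 2 ≤ (1 + δ) * (∫ x, ‖g x‖ ^ 2) + (1 + δ⁻¹) * ∫ x, ‖f x - g x‖ ^ 2 := by
  have hig : Integrable (fun x => ‖g x‖ ^ 2) volume := (hg.norm.pow 2).integrable_unitAddTorus
  have hid : Integrable (fun x => ‖f x - g x‖ ^ 2) volume :=
    ((hf.sub hg).norm.pow 2).integrable_unitAddTorus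
  calc ∫ x, ‖f x‖ ^ 2 ≤ ∫ x, ((1 + δ) * ‖g x‖ ^ 2 + (1 + δ⁻¹) * ‖f x - g x‖ ^ 2) :=
        integral_mono_of_nonneg (Eventually.of_forall fun x => sq_nonneg _)
          ((hig.const_mul _).add (hid.const_mul _))
          (Eventually.of_forall fun x => phaseCL_norm_sq_le_delta (f x) (g x) hδ)
    _ = (1 + δ) * (∫ x, ‖g x‖ ^ 2) + (1 + δ⁻¹) * ∫ x, ‖f x - g x‖ ^ 2 := by
        rw [integral_add (hig.const_mul _) (hid.const_mul _), integral_const_mul, integral_const_mul]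

/-- Partial derivatives of a difference of smooth fields, pointwise (`Torus.partialDeriv_sub`). -/
theorem phaseCL_partialDeriv_sub_apply {f g : UnitAddTorus (Fin 3) → EuclideanSpace ℝ (Fin 3)} (hf : IsSmooth f) (hg : IsSmooth g)
    (i : Fin 3) (x : UnitAddTorus (Fin 3)) :
    partialDeriv i (fun y => f y - g y) x = partialDeriv i f x - partialDeriv i g x :=
  congrFun (partialDeriv_sub (hf.isContDiff (by simp)) (hg.isContDiff (by simp)) i) x

/-- The integrand of `gradNormSq` of a smooth field is continuous. -/
theorem phaseCL_continuous_sum_norm_sq_partialDeriv {h : UnitAddTorus (Fin 3) → EuclideanSpace ℝ (Fin 3)} (hh : IsSmooth h) :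
    Continuous fun x => ∑ i, ‖partialDeriv i h x‖ ^ 2 :=
  continuous_finsetSum _ fun i _ => ((hh.partialDeriv i).continuous.norm).pow 2

/-- `‖∇f‖₂² ≤ (1+δ)‖∇g‖₂² + (1+δ⁻¹)‖∇(f-g)‖₂²` for smooth fields on `T³`
(`gradNormSq = ∫ ∑ᵢ ‖∂ᵢ·‖²`). -/
theorem phaseCL_gradNormSq_le_delta {f g : UnitAddTorus (Fin 3) → EuclideanSpace ℝ (Fin 3)} (hf : IsSmooth f) (hg : IsSmooth g)
    {δ : ℝ} (hδ : 0 < δ) :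
    gradNormSq f ≤ (1 + δ) * gradNormSq g + (1 + δ⁻¹) * gradNormSq (fun x => f x - g x) := by
  have hfg : IsSmooth (fun x => f x - g x) := hf.sub hg
  have hpt : ∀ x, ∑ i, ‖partialDeriv i f x‖ ^ 2 ≤
      (1 + δ) * ∑ i, ‖partialDeriv i g x‖ ^ 2 +
        (1 + δ⁻¹) * ∑ i, ‖partialDeriv i (fun y => f y - g y) x‖ ^ 2 := by
    intro x
    rw [Finset.mul_sum, Finset.mul_sum, ← Finset.sum_add_distrib]
    refine Finset.sum_le_sum fun i _ => ?_
    rw [phaseCL_partialDeriv_sub_apply hf hg]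
    exact phaseCL_norm_sq_le_delta _ _ hδ
  have hig := (phaseCL_continuous_sum_norm_sq_partialDeriv hg).integrable_unitAddTorus
  have hid := (phaseCL_continuous_sum_norm_sq_partialDeriv hfg).integrable_unitAddTorus
  unfold gradNormSq
  calc ∫ x, ∑ i, ‖partialDeriv i f x‖ ^ 2
        ≤ ∫ x, ((1 + δ) * ∑ i, ‖partialDeriv i g x‖ ^ 2 +
            (1 + δ⁻¹) * ∑ i, ‖partialDeriv i (fun y => f y - g y) x‖ ^ 2) :=
        integral_mono_of_nonneg
          (Eventually.of_forall fun x => Finset.sum_nonneg fun i _ => sq_nonneg _)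
          ((hig.const_mul _).add (hid.const_mul _)) (Eventually.of_forall hpt)
    _ = _ := by
        rw [integral_add (hig.const_mul _) (hid.const_mul _), integral_const_mul,
          integral_const_mul]

/-- `‖∇(a - b)‖₂² = ‖∇(b - a)‖₂²` for smooth fields. -/
theorem phaseCL_gradNormSq_sub_comm {a b : UnitAddTorus (Fin 3) → EuclideanSpace ℝ (Fin 3)} (ha : IsSmooth a) (hb : IsSmooth b) :
    gradNormSq (fun x => a x - b x) = gradNormSq (fun x => b x - a x) := by
  unfold gradNormSq
  congr 1
  funext x
  refine Finset.sum_congr rfl fun i _ => ?_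
  rw [phaseCL_partialDeriv_sub_apply ha hb, phaseCL_partialDeriv_sub_apply hb ha, norm_sub_rev]

/-- `‖∇(a - a)‖₂² = 0`. -/
theorem phaseCL_gradNormSq_sub_self {a : UnitAddTorus (Fin 3) → EuclideanSpace ℝ (Fin 3)} (ha : IsSmooth a) :
    gradNormSq (fun x => a x - a x) = 0 := by
  unfold gradNormSq
  have h : (fun x => ∑ i, ‖partialDeriv i (fun y => a y - a y) x‖ ^ 2) = fun _ => (0 : ℝ) := by
    funext x
    refine Finset.sum_eq_zero fun i _ => ?_
    rw [phaseCL_partialDeriv_sub_apply ha ha, sub_self, norm_zero]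
    ring
  rw [h, integral_zero]

/-! ## Two-out-of-three and continuity of `‖∇·‖₂²` -/

/-- Two-out-of-three in `L²`: `∫‖a - c‖² ≤ 2∫‖a - b‖² + 2∫‖b - c‖²` for continuous fields. -/
theorem phaseCL_integral_tri {a b c : UnitAddTorus (Fin 3) → EuclideanSpace ℝ (Fin 3)} (ha : Continuous a) (hb : Continuous b)
    (hc : Continuous c) :
    ∫ x, ‖a x - c x‖ ^ 2 ≤ 2 * (∫ x, ‖a x - b x‖ ^ 2) + 2 * ∫ x, ‖b x - c x‖ ^ 2 := by
  have h := phaseCL_integral_norm_sq_le_delta (ha.sub hc) (ha.sub hb) one_pos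
  simp only [Pi.sub_apply, sub_sub_sub_cancel_left] at h
  norm_num at h
  exact h

/-- Two-out-of-three in `Ḣ¹`: `‖∇(a - c)‖₂² ≤ 2‖∇(a - b)‖₂² + 2‖∇(b - c)‖₂²` for smooth fields. -/
theorem phaseCL_gradNormSq_tri {a b c : UnitAddTorus (Fin 3) → EuclideanSpace ℝ (Fin 3)} (ha : IsSmooth a) (hb : IsSmooth b)
    (hc : IsSmooth c) :
    gradNormSq (fun x => a x - c x) ≤
      2 * gradNormSq (fun x => a x - b x) + 2 * gradNormSq (fun x => b x - c x) := by
  have h := phaseCL_gradNormSq_le_delta (show IsSmooth (fun x => a x - c x) from ha.sub hc)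
    (show IsSmooth (fun x => a x - b x) from ha.sub hb) one_pos
  simp only [sub_sub_sub_cancel_left] at h
  norm_num at h
  exact h

/-- A nonnegative real sequence eventually below every `ε > 0` tends to `0`. -/
theorem phaseCL_tendsto_zero_of_eventually_le {g : ℕ → ℝ} (hg : ∀ n, 0 ≤ g n)
    (h : ∀ ε, 0 < ε → ∀ᶠ n in atTop, g n ≤ ε) : Tendsto g atTop (𝓝 0) := by
  refine tendsto_order.2 ⟨fun a ha => Eventually.of_forall fun n => ha.trans_le (hg n),
    fun b hb => ?_⟩
  exact (h (b / 2) (half_pos hb)).mono fun n hn => hn.trans_lt (half_lt_self hb)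

/-- Convergence in a seminormed group from eventual smallness of `‖yₙ - x‖²`. -/
theorem phaseCL_tendsto_of_norm_sub_sq {G : Type*} [SeminormedAddCommGroup G] {y : ℕ → G} {x : G}
    (h : ∀ ε, 0 < ε → ∀ᶠ n in atTop, ‖y n - x‖ ^ 2 ≤ ε) : Tendsto y atTop (𝓝 x) := by
  rw [tendsto_iff_norm_sub_tendsto_zero]
  have h2 : Tendsto (fun n => ‖y n - x‖ ^ 2) atTop (𝓝 0) :=
    phaseCL_tendsto_zero_of_eventually_le (fun n => sq_nonneg _) h
  have h3 := (Real.continuous_sqrt.tendsto 0).comp h2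
  rw [Real.sqrt_zero] at h3
  refine h3.congr fun n => ?_
  rw [Function.comp_apply, Real.sqrt_sq (norm_nonneg _)]

/-- **`Ḣ¹`-continuity of `‖∇·‖₂²` along sequences of smooth fields**: if `‖∇(aₙ - b)‖₂² → 0` then
`‖∇aₙ‖₂² → ‖∇b‖₂²` (from the `δ`-Young inequalities in both directions). -/
theorem phaseCL_tendsto_gradNormSq {a : ℕ → UnitAddTorus (Fin 3) → EuclideanSpace ℝ (Fin 3)} {b : UnitAddTorus (Fin 3) → EuclideanSpace ℝ (Fin 3)} (ha : ∀ n, IsSmooth (a n))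
    (hb : IsSmooth b) (h : ∀ ε, 0 < ε → ∀ᶠ n in atTop, gradNormSq (fun x => a n x - b x) ≤ ε) :
    Tendsto (fun n => gradNormSq (a n)) atTop (𝓝 (gradNormSq b)) := by
  set L := gradNormSq b with hL
  have hL0 : 0 ≤ L := gradNormSq_nonneg _
  rw [Metric.tendsto_atTop]
  intro ε hε
  set δ : ℝ := ε / (4 * (3 * L + 3)) with hδ_def
  have hδ : 0 < δ := by positivity
  have hδ3 : δ * (3 * L + 3) = ε / 4 := by
    rw [hδ_def]
    field_simp
  have hδ' : δ * (3 * L + 2) ≤ ε / 4 := by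
    calc δ * (3 * L + 2) ≤ δ * (3 * L + 3) := mul_le_mul_of_nonneg_left (by linarith) hδ.le
      _ = ε / 4 := hδ3
  set η : ℝ := min 1 (ε / 4 / (1 + δ⁻¹)) with hη_def
  have hη : 0 < η := by positivity
  obtain ⟨N, hN⟩ := eventually_atTop.1 (h η hη)
  refine ⟨N, fun n hn => ?_⟩
  have he := hN n hn
  have he1 : gradNormSq (fun x => a n x - b x) ≤ 1 := he.trans (min_le_left _ _)
  have he2 : (1 + δ⁻¹) * gradNormSq (fun x => a n x - b x) ≤ ε / 4 := by
    have h' : gradNormSq (fun x => a n x - b x) ≤ ε / 4 / (1 + δ⁻¹) := he.trans (min_le_right _ _)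
    rwa [le_div_iff₀ (by positivity), mul_comm] at h'
  have hg0 : 0 ≤ gradNormSq (a n) := gradNormSq_nonneg _
  have hd0 : 0 ≤ gradNormSq (fun x => a n x - b x) := gradNormSq_nonneg _
  have h1 := phaseCL_gradNormSq_le_delta (ha n) hb hδ
  have h2 := phaseCL_gradNormSq_le_delta hb (ha n) hδ
  rw [phaseCL_gradNormSq_sub_comm hb (ha n)] at h2
  have h3 := phaseCL_gradNormSq_le_delta (ha n) hb one_pos
  norm_num at h3
  have hδL : δ * L ≤ δ * (3 * L + 2) := mul_le_mul_of_nonneg_left (by linarith) hδ.le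
  have hδg : δ * gradNormSq (a n) ≤ δ * (3 * L + 2) :=
    mul_le_mul_of_nonneg_left (by linarith) hδ.le
  rw [Real.dist_eq, abs_sub_lt_iff]
  constructor
  · linarith
  · linarith

/-! ## Time continuity of jointly smooth fields in `L²` and `Ḣ¹` -/

/-- `∫‖h‖² ≤ η²` when `‖h x‖ ≤ η` everywhere (`vol(T³) = 1`). -/
theorem phaseCL_integral_norm_sq_le_of_bound {h : UnitAddTorus (Fin 3) → EuclideanSpace ℝ (Fin 3)} {η : ℝ} (hb : ∀ x, ‖h x‖ ≤ η) :
    ∫ x, ‖h x‖ ^ 2 ≤ η ^ 2 := by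
  calc ∫ x, ‖h x‖ ^ 2 ≤ ∫ _ : UnitAddTorus (Fin 3), η ^ 2 :=
        integral_mono_of_nonneg (Eventually.of_forall fun x => sq_nonneg _) (integrable_const _)
          (Eventually.of_forall fun x => pow_le_pow_left₀ (norm_nonneg _) (hb x) 2)
    _ = η ^ 2 := by simp

/-- **Time continuity in `L²` and `Ḣ¹`** of a jointly smooth field on `[0,∞) × T³`: for `t ≥ 0` and
`ε > 0`, eventually as `s → t` within `[0,∞)`, `∫‖v s - v t‖² ≤ ε` and `‖∇(v s - v t)‖₂² ≤ ε`
(uniform-in-space continuity of `v` and of its partial derivatives, tube lemma). -/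
theorem phaseCL_time_continuity :
    ∀ (v : ℝ → UnitAddTorus (Fin 3) → EuclideanSpace ℝ (Fin 3)) (t ε : ℝ),
      IsSmoothSpaceTimeOn (Set.Ici 0) v → 0 ≤ t → 0 < ε →
      ∀ᶠ s in 𝓝[Set.Ici 0] t, (∫ x, ‖v s x - v t x‖ ^ 2) ≤ ε ∧
        gradNormSq (fun x => v s x - v t x) ≤ ε := by
  intro v t ε hv ht hε
  set η : ℝ := min 1 (ε / 3) with hη_def
  have hη : 0 < η := by positivity
  have hη1 : η ≤ 1 := min_le_left _ _
  have hη3 : η ≤ ε / 3 := min_le_right _ _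
  have hη2 : η ^ 2 ≤ ε / 3 := by nlinarith
  have htS : t ∈ Ici (0 : ℝ) := mem_Ici.2 ht
  have h0 := hv.eventually_norm_sub_lt htS hη
  have h1 : ∀ i : Fin 3, ∀ᶠ s in 𝓝[Ici 0] t, ∀ x,
      ‖partialDeriv i (v s) x - partialDeriv i (v t) x‖ < η :=
    fun i => (hv.partialDeriv (uniqueDiffOn_Ici 0) i).eventually_norm_sub_lt htS hη
  filter_upwards [h0, eventually_all.2 h1, self_mem_nhdsWithin] with s hs hs' hsS
  have hsm_s : IsSmooth (v s) := hv.isSmooth_slice hsS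
  have hsm_t : IsSmooth (v t) := hv.isSmooth_slice htS
  constructor
  · exact (phaseCL_integral_norm_sq_le_of_bound fun x => (hs x).le).trans (by linarith)
  · unfold gradNormSq
    calc ∫ x, ∑ i, ‖partialDeriv i (fun y => v s y - v t y) x‖ ^ 2
          ≤ ∫ _ : UnitAddTorus (Fin 3), (3 : ℝ) * η ^ 2 := by
          refine integral_mono_of_nonneg
            (Eventually.of_forall fun x => Finset.sum_nonneg fun i _ => sq_nonneg _)
            (integrable_const _) (Eventually.of_forall fun x => ?_)
          calc ∑ i, ‖partialDeriv i (fun y => v s y - v t y) x‖ ^ 2 ≤ ∑ _i : Fin 3, η ^ 2 :=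
                Finset.sum_le_sum fun i _ => by
                  rw [phaseCL_partialDeriv_sub_apply hsm_s hsm_t]
                  exact pow_le_pow_left₀ (norm_nonneg _) (hs' i x).le 2
            _ = 3 * η ^ 2 := by simp
      _ = 3 * η ^ 2 := by simp
      _ ≤ ε := by linarith

/-! ## The phase space `H`: distances, classes, enstrophy of represented states -/

/-- **The `H`-distance of two states is the `L²`-distance of any representatives.** -/
theorem phaseCL_norm_sub_sq_eq {x y : Hsp} {f g : UnitAddTorus (Fin 3) → EuclideanSpace ℝ (Fin 3)} (hx : rep x =ᵐ[volume] f)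
    (hy : rep y =ᵐ[volume] g) : ‖x - y‖ ^ 2 = ∫ z, ‖f z - g z‖ ^ 2 := by
  rw [Submodule.coe_norm, Submodule.coe_sub, ← integral_norm_sq_coe_eq]
  refine integral_congr_ae ?_
  unfold rep at hx hy
  filter_upwards [Lp.coeFn_sub (x : Lp (EuclideanSpace ℝ (Fin 3)) 2 (volume : Measure (UnitAddTorus (Fin 3)))) (y : Lp (EuclideanSpace ℝ (Fin 3)) 2 volume), hx, hy]
    with z hz hxz hyz
  rw [hz, Pi.sub_apply, hxz, hyz]

/-- States of `H` with a.e.-equal representatives are equal. -/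
theorem phaseCL_eq_of_rep_ae_eq {x y : Hsp} (h : rep x =ᵐ[volume] rep y) : x = y :=
  Subtype.ext (Lp.ext h)

/-- A smooth solenoidal mean-zero field has a class in `H` (`𝒱 ⊆ H`). -/
theorem phaseCL_exists_rep_ae_eq {w : UnitAddTorus (Fin 3) → EuclideanSpace ℝ (Fin 3)} (hw : IsSmooth w) (hdiv : IsDivFree w)
    (hmz : HasZeroMean w) : ∃ x : Hsp, rep x =ᵐ[volume] w :=
  ⟨⟨(hw.memLp 2).toLp w,
      smoothSolenoidal_subset_energySpace ⟨w, hw, hdiv, hmz, (hw.memLp 2).coeFn_toLp⟩⟩,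
    (hw.memLp 2).coeFn_toLp⟩

/-- The enstrophy observable of a state represented by a smooth field is its classical `‖∇·‖₂²`
(`eGradNormSq` only sees the a.e. class; `Torus.gradNormSq_eq_toReal_eGradNormSq_holds`). -/
theorem phaseCL_enstrophyObs_eq {x : Hsp} {w : UnitAddTorus (Fin 3) → EuclideanSpace ℝ (Fin 3)} (hx : rep x =ᵐ[volume] w) (hw : IsSmooth w) :
    enstrophyObs x = gradNormSq w := by
  unfold enstrophyObs
  rw [eGradNormSq_congr_ae hx, gradNormSq_eq_toReal_eGradNormSq_holds hw]

/-- A state represented by a smooth field has finite enstrophy. -/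
theorem phaseCL_eGradNormSq_rep_ne_top {x : Hsp} {w : UnitAddTorus (Fin 3) → EuclideanSpace ℝ (Fin 3)} (hx : rep x =ᵐ[volume] w)
    (hw : IsSmooth w) : eGradNormSq (rep x) ≠ ⊤ := by
  rw [eGradNormSq_congr_ae hx]
  exact (eGradNormSq_lt_top hw).ne

end Summit.AnomalousDissipation.AnomalousDissipation.Theorems.ChainRealisation.SeparatrixFluxPinning

end
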